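/-
Copyright: seat `ym-line-cbag-p2` (prover-ym-line-cbag-p2-g0-0), route `ColdBoxAllGroups`, crux `BulkAllGroups`
(stmt-QuantumFields-22255), line `dlr-chessboard-G` (skeleton `Cruxes/BulkAllGroups/Lines/birth.lean`).
-/
import Summits.QuantumFields.YangMills.Theorems.ColdBoxAllGroupsBulkAllGroupsCrudeGoodLargeFieldG
import Summits.QuantumFields.YangMills.Theorems.ColdBoxAllGroupsOneScaleDefs
import Summits.QuantumFields.YangMills.Theorems.WeakCouplingRatesBulkDominatesColdBoxWKernelGoodEvent

/-!
# Crux `BulkAllGroups` (stmt-QuantumFields-22255), expansion stubs `stub_kernelMeanExpansionG` / `stub_kernelCovExpansionG`: conditioning the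
# box kernel with a crude-good datum on the small-field event `coldGoodSetG` (helper H-T6-G, YM side) — G-port of `…KernelGoodEvent`

Uniformly over crude-good data `ω` (scale `β^{2δ−1}`, box `H = ⌈β^θ⌉`), for any compact `G` with a continuous unitary representation `ρ` of
degree `N ≥ 1`, the box kernel `γ(·|ω) = boxKernelG ρ β H ω` gives the large-field event mass `≤ e^{−β^ε}` for `ε > 3θ + δ`
(`boxKernelG_largeField_rarity_crudeGood`, brick B5-G); hence (tree `abs_integral_sub_integral_cond_le`, `abs_cov_sub_cov_cond_le`) conditioning
on the sibling line's small-field event `coldGoodSetG ρ H β ε` (`Theorems/ColdBoxAllGroupsOneScaleDefs.lean`) moves bounded means by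
`≤ 2M·e^{−β^ε}` and bounded connected two-point functions by `≤ 6M_fM_g·e^{−β^ε}` — the YM-side restriction step of the one-scale expansions
with datum (the flat case is the sibling line's `abs_boxPlaqCov_sub_cond_le_of_rep`).

* `boxKernelG_real_coldGoodSetG_compl_le` — `γ((coldGoodSetG)ᶜ|ω) ≤ e^{−β^ε}` eventually, ∀ crude-good `ω`;
* `isProbabilityMeasure_boxKernelG`, `boxKernelG_coldGoodSetG_ne_zero`;
* **`abs_boxKernelG_integral_sub_cond_le`**, **`abs_boxKernelG_cov_sub_cond_le`**.
No sorry, standard axioms, no new definition.  NOT a claim about the mass gap; the Yang–Mills mass gap is NOT proved by any of this.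
-/

set_option autoImplicit false

noncomputable section

open MeasureTheory ProbabilityTheory Finset Real
open Literature.Probability.LatticeModels
open Literature.MathematicalPhysics.QuantumLattice
open Literature.MathematicalPhysics.QuantumFieldTheory
open Literature.MathematicalPhysics.QuantumFieldTheory.AxialGauge
open Summit.QuantumFields.YangMills.Theorems.WeakCouplingRates

namespace Summit.QuantumFields.YangMills.Theorems.ColdBoxAllGroups

variable {N : ℕ} [NeZero N] {G : Type*} [Group G] [TopologicalSpace G] [IsTopologicalGroup G] [CompactSpace G]
  [MeasurableSpace G] [BorelSpace G] [SecondCountableTopology G]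
variable (ρ : G →* Matrix (Fin N) (Fin N) ℂ) (hρu : ∀ g, ρ g ∈ Matrix.unitaryGroup (Fin N) ℂ) (hρc : Continuous ρ)

omit [NeZero N] in
include hρc in
/-- The box kernel is a probability measure. -/
theorem isProbabilityMeasure_boxKernelG (β : ℝ) (H : ℕ) (ω : LGConfig 4 G) :
    IsProbabilityMeasure (boxKernelG ρ β H ω) := by
  unfold boxKernelG
  exact isProbabilityMeasure_ymSpecification _ hρc β _ _

include hρu hρc in
/-- **Large fields under the kernel, uniformly over crude-good data**: for `0 < θ`, `0 ≤ δ`, `3θ + δ < ε`, eventually in `β`, for every crude-good `ω`,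
`boxKernelG ρ β H ω (coldGoodSetG ρ H β ε)ᶜ ≤ e^{−β^ε}` (`H = ⌈β^θ⌉`). -/
theorem boxKernelG_real_coldGoodSetG_compl_le {θ δ ε : ℝ} (hθ : 0 < θ) (hδ : 0 ≤ δ) (hε : 3 * θ + δ < ε) :
    ∃ β₀ : ℝ, ∀ β : ℝ, β₀ ≤ β → ∀ ω : LGConfig 4 G, CrudeGoodG ρ β δ ⌈β ^ θ⌉₊ ω →
      (boxKernelG ρ β ⌈β ^ θ⌉₊ ω).real (coldGoodSetG ρ ⌈β ^ θ⌉₊ β ε)ᶜ ≤ Real.exp (-(β ^ ε)) := by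
  obtain ⟨β₀, hβ₀⟩ := boxKernelG_largeField_rarity_crudeGood ρ hρu hρc hθ hδ hε
  refine ⟨β₀, fun β hβ ω hω => ?_⟩
  rw [coldGoodSetG, compl_compl]
  exact hβ₀ β hβ ω hω

omit [NeZero N] in
include hρc in
/-- Eventually the good event has positive kernel mass (its complement has mass `≤ e^{−β^ε} < 1`). -/
theorem boxKernelG_coldGoodSetG_ne_zero {β ε : ℝ} (hβ : 0 < β) {H : ℕ} {ω : LGConfig 4 G}
    (hbad : (boxKernelG ρ β H ω).real (coldGoodSetG ρ H β ε)ᶜ ≤ Real.exp (-(β ^ ε))) :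
    boxKernelG ρ β H ω (coldGoodSetG ρ H β ε) ≠ 0 := by
  haveI := isProbabilityMeasure_boxKernelG ρ hρc β H ω
  have hbad1 : (boxKernelG ρ β H ω).real (coldGoodSetG ρ H β ε)ᶜ < 1 := lt_of_le_of_lt hbad (by
    rw [Real.exp_lt_one_iff]
    have : 0 < β ^ ε := Real.rpow_pos_of_pos hβ ε
    linarith)
  intro h0
  have h1 : (boxKernelG ρ β H ω).real (coldGoodSetG ρ H β ε) = 0 := by rw [measureReal_def, h0, ENNReal.toReal_zero]
  have h2 : (boxKernelG ρ β H ω).real (coldGoodSetG ρ H β ε) + (boxKernelG ρ β H ω).real (coldGoodSetG ρ H β ε)ᶜ = 1 := by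
    rw [measureReal_add_measureReal_compl (measurableSet_coldGoodSetG ρ hρc β ε), probReal_univ]
  linarith

include hρu hρc in
/-- **H-T6 for MEANS (the `KernelMeanExpansion` restriction step)**: for `0 < θ`, `0 ≤ δ`, `3θ + δ < ε`, eventually in `β`, for every crude-good datum
`ω` and every bounded measurable observable `f` (`|f| ≤ M_f`),
`|E_{γ(·|ω)}[f] − E_{γ(·|ω)}[f | coldGoodSet]| ≤ 2M_f·e^{−β^ε}`. -/
theorem abs_boxKernelG_integral_sub_cond_le {θ δ ε : ℝ} (hθ : 0 < θ) (hδ : 0 ≤ δ) (hε : 3 * θ + δ < ε) :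
    ∃ β₀ : ℝ, ∀ β : ℝ, β₀ ≤ β → ∀ ω : LGConfig 4 G, CrudeGoodG ρ β δ ⌈β ^ θ⌉₊ ω →
      ∀ (f : LGConfig 4 G → ℝ) (Mf : ℝ), Measurable f → (∀ U, |f U| ≤ Mf) →
        |(∫ U, f U ∂(boxKernelG ρ β ⌈β ^ θ⌉₊ ω)) - ∫ U, f U ∂((boxKernelG ρ β ⌈β ^ θ⌉₊ ω)[|coldGoodSetG ρ ⌈β ^ θ⌉₊ β ε])| ≤
          2 * Mf * Real.exp (-(β ^ ε)) := by
  obtain ⟨β₀, hβ₀⟩ := boxKernelG_real_coldGoodSetG_compl_le ρ hρu hρc hθ hδ hε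
  refine ⟨max β₀ 1, fun β hβ ω hω f Mf hfm hM => ?_⟩
  have hb0 : β₀ ≤ β := (le_max_left _ _).trans hβ
  have hβ1 : (1 : ℝ) ≤ β := (le_max_right _ _).trans hβ
  set μ := boxKernelG ρ β ⌈β ^ θ⌉₊ ω with hμ
  haveI : IsProbabilityMeasure μ := isProbabilityMeasure_boxKernelG ρ hρc β _ ω
  have hbad : μ.real (coldGoodSetG ρ ⌈β ^ θ⌉₊ β ε)ᶜ ≤ Real.exp (-(β ^ ε)) := hβ₀ β hb0 ω hω
  have hG0 : μ (coldGoodSetG ρ ⌈β ^ θ⌉₊ β ε) ≠ 0 := boxKernelG_coldGoodSetG_ne_zero ρ hρc (by linarith) hbad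
  have hMf0 : 0 ≤ Mf := (abs_nonneg _).trans (hM fun _ => 1)
  have hfi : Integrable f μ := integrable_of_bound hfm.aestronglyMeasurable hM
  have key := abs_integral_sub_integral_cond_le (μ := μ) (measurableSet_coldGoodSetG ρ hρc β ε) hG0 hfi hM
  calc _ ≤ 2 * Mf * μ.real (coldGoodSetG ρ ⌈β ^ θ⌉₊ β ε)ᶜ := key
    _ ≤ 2 * Mf * Real.exp (-(β ^ ε)) := mul_le_mul_of_nonneg_left hbad (by positivity)

include hρu hρc in
/-- **H-T6 for COVARIANCES (the `KernelCovExpansion` restriction step)**: for `0 < θ`, `0 ≤ δ`, `3θ + δ < ε`, eventually in `β`, for every crude-good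
datum `ω` and bounded measurable `f, g` (`|f| ≤ M_f`, `|g| ≤ M_g`),
`|Cov_{γ(·|ω)}(f,g) − Cov_{γ(·|ω)[|coldGoodSet]}(f,g)| ≤ 6M_fM_g·e^{−β^ε}`. -/
theorem abs_boxKernelG_cov_sub_cond_le {θ δ ε : ℝ} (hθ : 0 < θ) (hδ : 0 ≤ δ) (hε : 3 * θ + δ < ε) :
    ∃ β₀ : ℝ, ∀ β : ℝ, β₀ ≤ β → ∀ ω : LGConfig 4 G, CrudeGoodG ρ β δ ⌈β ^ θ⌉₊ ω →
      ∀ (f g : LGConfig 4 G → ℝ) (Mf Mg : ℝ), Measurable f → Measurable g →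
        (∀ U, |f U| ≤ Mf) → (∀ U, |g U| ≤ Mg) →
        |((∫ U, f U * g U ∂(boxKernelG ρ β ⌈β ^ θ⌉₊ ω)) -
              (∫ U, f U ∂(boxKernelG ρ β ⌈β ^ θ⌉₊ ω)) * (∫ U, g U ∂(boxKernelG ρ β ⌈β ^ θ⌉₊ ω))) -
            ((∫ U, f U * g U ∂((boxKernelG ρ β ⌈β ^ θ⌉₊ ω)[|coldGoodSetG ρ ⌈β ^ θ⌉₊ β ε])) -
              (∫ U, f U ∂((boxKernelG ρ β ⌈β ^ θ⌉₊ ω)[|coldGoodSetG ρ ⌈β ^ θ⌉₊ β ε])) *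
                (∫ U, g U ∂((boxKernelG ρ β ⌈β ^ θ⌉₊ ω)[|coldGoodSetG ρ ⌈β ^ θ⌉₊ β ε])))| ≤
          6 * Mf * Mg * Real.exp (-(β ^ ε)) := by
  obtain ⟨β₀, hβ₀⟩ := boxKernelG_real_coldGoodSetG_compl_le ρ hρu hρc hθ hδ hε
  refine ⟨max β₀ 1, fun β hβ ω hω f g Mf Mg hfm hgm hMf hMg => ?_⟩
  have hb0 : β₀ ≤ β := (le_max_left _ _).trans hβ
  have hβ1 : (1 : ℝ) ≤ β := (le_max_right _ _).trans hβ
  set μ := boxKernelG ρ β ⌈β ^ θ⌉₊ ω with hμ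
  haveI : IsProbabilityMeasure μ := isProbabilityMeasure_boxKernelG ρ hρc β _ ω
  have hbad : μ.real (coldGoodSetG ρ ⌈β ^ θ⌉₊ β ε)ᶜ ≤ Real.exp (-(β ^ ε)) := hβ₀ β hb0 ω hω
  have hG0 : μ (coldGoodSetG ρ ⌈β ^ θ⌉₊ β ε) ≠ 0 := boxKernelG_coldGoodSetG_ne_zero ρ hρc (by linarith) hbad
  have hMf0 : 0 ≤ Mf := (abs_nonneg _).trans (hMf fun _ => 1)
  have hMg0 : 0 ≤ Mg := (abs_nonneg _).trans (hMg fun _ => 1)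
  have hfi : Integrable f μ := integrable_of_bound hfm.aestronglyMeasurable hMf
  have hgi : Integrable g μ := integrable_of_bound hgm.aestronglyMeasurable hMg
  have hfgi : Integrable (fun U => f U * g U) μ := integrable_of_bound (hfm.mul hgm).aestronglyMeasurable (C := Mf * Mg)
    (fun U => by rw [abs_mul]; exact mul_le_mul (hMf U) (hMg U) (abs_nonneg _) hMf0)
  have key := abs_cov_sub_cov_cond_le (μ := μ) (measurableSet_coldGoodSetG ρ hρc β ε) hG0 hfi hgi hfgi hMf hMg
  calc _ ≤ 6 * Mf * Mg * μ.real (coldGoodSetG ρ ⌈β ^ θ⌉₊ β ε)ᶜ := key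
    _ ≤ 6 * Mf * Mg * Real.exp (-(β ^ ε)) := mul_le_mul_of_nonneg_left hbad (by positivity)

end Summit.QuantumFields.YangMills.Theorems.ColdBoxAllGroups

end
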